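import Literature.AlgebraicGeometry.Motives.AbelianVarietyKernelComponentAction
import Literature.AlgebraicGeometry.Motives.AbelianVarietySimpleFactorsUnique
import Literature.AlgebraicGeometry.ComplexMultiplication.EndAlgebraCommSubalgebraDegreeBound
import Literature.NumberTheory.DiophantineGeometry.AVIsogenyTateFreeHomProofs
import Mathlib.RingTheory.Ideal.Norm.AbsNorm
import HarnessLib

/-!
# CM abelian varieties are simple with operators; Schur's lemma for `𝓞_K`-linear homomorphisms

Shimura 1998 §5.1 Proposition 1 («`[𝔖 : Q] ≤ 2n`» for a commutative semisimple `𝔖 ⊂ End_Q(A)`;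
tree: `ComplexMultiplication.Subalgebra.finrank_le_two_mul_dim`, over `ℂ`) bounds the degree of a
number field acting on an abelian variety: an action `ω : 𝓞_K → End W` on a complex abelian
variety of positive dimension forces `[K:ℚ] ≤ 2 dim W`.  Hence an abelian variety `A` with complex
multiplication by `𝓞_K`, `[K:ℚ] = 2 dim A` (the tree's CM vocabulary `ι : 𝓞 K →+* End A`), has NO
`𝓞_K`-stable abelian subvariety of dimension strictly between `0` and `dim A`: **`(A, ι)` is
`𝓞_K`-simple**, the hypothesis of the with-operators files
`Motives/AbelianVarietyEquivariantSchur`, `…KernelComponentAction`, `…EquivariantSimpleIsotypic`,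
`…EquivariantHomCount`.  In particular Schur's lemma with operators applies:

* `AbelianVariety.injective_of_ringOfIntegersAction` — any field: an action
  `ω : 𝓞 K →+* End W` on an abelian variety of positive dimension is injective (`ω(N(a)) = N(a) ≠ 0`
  in the torsion-free `End W`);
* `AbelianVariety.finrank_le_two_mul_dim_of_ringOfIntegersAction` — over `ℂ`:
  `[K:ℚ] ≤ 2 dim W` as soon as `𝓞_K` acts on `W`, `dim W > 0` (Prop. 1 applied to the reduced
  commutative subalgebra `ℚ·ω(𝓞_K) ⊂ End⁰(W)` of degree `[K:ℚ]`, tree `cmSubalgebra`,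
  `finrank_cmSubalgebra`);
* `AbelianVariety.simpleFor_of_finrank_eq_two_mul_dim` — **a complex abelian variety with
  `𝓞_K`-action and `[K:ℚ] = 2 dim A` is `𝓞_K`-simple**;
* `AbelianVariety.isIsogeny_of_cm_of_equivariant_ne_zero` — **Schur's lemma for CM abelian
  varieties**: a non-zero `𝓞_K`-linear homomorphism `f : A ⟶ B` between complex abelian varieties
  with `𝓞_K`-actions and `[K:ℚ] = 2 dim A = 2 dim B` is an ISOGENY (no simplicity assumed;
  `isIsogeny_of_simpleFor_of_simpleFor`); `AbelianVariety.isIsogeny_end_of_cm_of_equivariant_ne_zero`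
  — every non-zero `𝓞_K`-linear endomorphism of a CM abelian variety is an isogeny.

Everything is proved; no definition, no named fact (D-0026).

## References

* G. Shimura, *Abelian Varieties with Complex Multiplication and Modular Functions* (1998), §5.1
  Proposition 1 («`[𝔖 : Q] ≤ 2n`») and Proposition 3 (structure of an abelian variety with a field
  of degree `2 dim A` in `End_Q(A)`). [Shimura1998]
* D. Mumford, *Abelian Varieties* (1970), §19 Thm. 3 and Cor. 2 of Thm. 1. [MumfordAV1970]
* J. S. Milne, *Complex Multiplication* (course notes, 2006), Ch. I §3 (CM abelian varieties up to
  isogeny). [MilneCM2006]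
-/

noncomputable section

universe u

open CategoryTheory CategoryTheory.Limits AlgebraicGeometry NumberField
open Literature.AlgebraicGeometry.ComplexMultiplication
open Literature.AlgebraicGeometry.ComplexMultiplication.IsCMTypeRealisation (ρ cmSubalgebra
  cmSubalgebra_comm cmSubalgebra_isReduced finrank_cmSubalgebra)

namespace Literature.AlgebraicGeometry.Motives

namespace AbelianVariety

variable {K : Type} [Field K] [NumberField K]

/-! ### Actions of `𝓞_K` are injective -/

/-- **An action of `𝓞_K` on an abelian variety of positive dimension is injective** (any ground
field): if `ω(a) = 0` with `a ≠ 0`, then the norm `n = N(a) ∈ (a)` is a non-zero integer with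
`ω(n) = n • 𝟙 W = 0`, contradicting the torsion-freeness of `End W` (`𝟙 W ≠ 0`).
[cite: MumfordAV1970, §19 Thm. 3 and Cor. 2] -/
theorem injective_of_ringOfIntegersAction {k : Type u} [Field k] {W : AbelianVariety k}
    (ω : 𝓞 K →+* End W) (hW : 0 < W.dim) : Function.Injective ω := by
  rw [injective_iff_map_eq_zero]
  intro a ha
  by_contra ha0
  set I : Ideal (𝓞 K) := Ideal.span {a} with hI
  have hn0 : Ideal.absNorm I ≠ 0 := by
    rw [Ne, Ideal.absNorm_eq_zero_iff, hI, Ideal.span_singleton_eq_bot]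
    exact ha0
  have hmem : ((Ideal.absNorm I : ℕ) : 𝓞 K) ∈ I := Ideal.absNorm_mem I
  obtain ⟨c, hc⟩ := Ideal.mem_span_singleton'.1 hmem
  have h1 : ω ((Ideal.absNorm I : ℕ) : 𝓞 K) = 0 := by rw [← hc, map_mul, ha, mul_zero]
  rw [map_natCast, ← nsmul_one] at h1
  exact id_ne_zero_of_dim_pos hW (hom_eq_zero_of_nsmul_eq_zero hn0 h1)

/-! ### Shimura's Proposition 1 for `𝓞_K`-actions -/

/-- **`[K:ℚ] ≤ 2 dim W` whenever `𝓞_K` acts on a complex abelian variety `W` of positive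
dimension** (Shimura 1998 §5.1 Prop. 1 for the commutative reduced subalgebra
`ℚ·ω(𝓞_K) ⊂ End⁰(W)`, which has degree `[K:ℚ]` because `ω` and `End W → End⁰ W` are injective).
[cite: Shimura1998, §5.1 Proposition 1] -/
theorem finrank_le_two_mul_dim_of_ringOfIntegersAction {W : AbelianVariety ℂ}
    (ω : 𝓞 K →+* End W) (hW : 0 < W.dim) : Module.finrank ℚ K ≤ 2 * W.dim := by
  have hρ : Function.Injective (ρ ω) :=
    (endAlgebra.of_injective_of_charZero (A := W)).comp (injective_of_ringOfIntegersAction ω hW)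
  haveI := cmSubalgebra_isReduced hρ
  rw [← finrank_cmSubalgebra hρ]
  exact Subalgebra.finrank_le_two_mul_dim (cmSubalgebra ω) (cmSubalgebra_comm ω)

/-! ### CM abelian varieties are `𝓞_K`-simple -/

/-- **A complex abelian variety with complex multiplication by `𝓞_K`, `[K:ℚ] = 2 dim A`, is
`𝓞_K`-simple**: it has no `𝓞_K`-stable abelian subvariety `W ↪ A` (`W` with an `𝓞_K`-action
making the closed immersion equivariant) of dimension `0 < dim W < dim A` — indeed no abelian
variety of dimension `0 < dim W < [K:ℚ]/2` carries an `𝓞_K`-action at all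
(`finrank_le_two_mul_dim_of_ringOfIntegersAction`). [cite: Shimura1998, §5.1 Propositions 1 and 3] -/
theorem simpleFor_of_finrank_eq_two_mul_dim {A : AbelianVariety ℂ} (ι : 𝓞 K →+* End A)
    (hK : Module.finrank ℚ K = 2 * A.dim) :
    ∀ (W : AbelianVariety ℂ) (ω : 𝓞 K →+* End W) (w : W ⟶ A),
      IsClosedImmersion (Hom.toSchemeHom w) →
      (∀ r : 𝓞 K, w ≫ End.asHom (ι r) = End.asHom (ω r) ≫ w) → 0 < W.dim → W.dim < A.dim →
      False := by
  intro W ω _ _ _ h0 hlt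
  have h := finrank_le_two_mul_dim_of_ringOfIntegersAction ω h0
  omega

/-! ### Schur's lemma for CM abelian varieties -/

/-- **Schur's lemma for CM abelian varieties.** Let `A`, `B` be complex abelian varieties with
actions `ιA : 𝓞 K →+* End A`, `ιB : 𝓞 K →+* End B` of the maximal order of a number field `K`
with `[K:ℚ] = 2 dim A = 2 dim B`. Then every non-zero `𝓞_K`-linear homomorphism `f : A ⟶ B`
(`ιA r ≫ f = f ≫ ιB r`) is an ISOGENY: both are `𝓞_K`-simple
(`simpleFor_of_finrank_eq_two_mul_dim`) and Schur's lemma with operators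
(`isIsogeny_of_simpleFor_of_simpleFor`) applies. No simplicity of `A` or `B` is assumed.
[cite: Shimura1998, §5.1 Propositions 1 and 3] [cite: MumfordAV1970, §19 Cor. 2 of Thm. 1] -/
theorem isIsogeny_of_cm_of_equivariant_ne_zero {A B : AbelianVariety ℂ} (ιA : 𝓞 K →+* End A)
    (ιB : 𝓞 K →+* End B) (hA : Module.finrank ℚ K = 2 * A.dim)
    (hB : Module.finrank ℚ K = 2 * B.dim) (f : A ⟶ B)
    (hf : ∀ r : 𝓞 K, End.asHom (ιA r) ≫ f = f ≫ End.asHom (ιB r)) (hf0 : f ≠ 0) :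
    IsIsogeny f :=
  isIsogeny_of_simpleFor_of_simpleFor f ιA ιB hf (simpleFor_of_finrank_eq_two_mul_dim ιA hA)
    (simpleFor_of_finrank_eq_two_mul_dim ιB hB) hf0

/-- **Every non-zero `𝓞_K`-linear endomorphism of a CM abelian variety is an isogeny**
(`[K:ℚ] = 2 dim A`; the centraliser of `K` in `End⁰(A)` is a division algebra).
[cite: Shimura1998, §5.1 Propositions 1 and 3] [cite: MumfordAV1970, §19 Cor. 2 of Thm. 1] -/
theorem isIsogeny_end_of_cm_of_equivariant_ne_zero {A : AbelianVariety ℂ} (ι : 𝓞 K →+* End A)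
    (hA : Module.finrank ℚ K = 2 * A.dim) (g : A ⟶ A)
    (hg : ∀ r : 𝓞 K, End.asHom (ι r) ≫ g = g ≫ End.asHom (ι r)) (hg0 : g ≠ 0) : IsIsogeny g :=
  isIsogeny_of_cm_of_equivariant_ne_zero ι ι hA hA g hg hg0

end AbelianVariety

end Literature.AlgebraicGeometry.Motives

end
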